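import Literature.NumberTheory.LFunctions.KMVMomentAsymptoticsBeyondDiagonal
import Literature.NumberTheory.LFunctions.KMVDiagonalSlack

/-!
# Route `PrimeLevelFamEdge`, crux K_B `BeyondDiagonalBeatsQuarter` (stmt-Parity-20343), line `birth`:
# the registered heart S2u in T₂-BAND FORM — floor-free, fact-free

The registered heart of the line (rev 6, stub `stub_secondCorrectionUpperSomewhere`) is S2u: for every
window `(1, Δ]` and every MA-consistent `(T₁, T₂)`, on SOME sub-window `(a, b) ⊆ [1, min Δ 2]` with
`a < 3/2`, `secondMomentForm Δ' X² 1 + T₂ Δ' X² 1 < 2·(linForm Δ' X² 1)²`. Since `lin Δ' X² 1 = 2`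
and `second Δ' X² 1 = 4 + 4/Δ'` (`KMV2000.linForm_X_sq_one`, `secondMomentForm_X_sq_one`), this is
PURE ALGEBRA away from the off-diagonal main term: the inequality at `Δ' > 0` is EQUIVALENT to the
band condition `T₂ Δ' X² 1 < 4(Δ' − 1)/Δ'` (`= KMV2000.diagSlack Δ' X² 1`). The earlier Theorems files
derive the OLD two-sided S2 from the band modulo Bettin + Petersson (`…_of_T₂_band`, p525223;
`…_of_T₂_band_pb`, p530790); for S2u itself no printed fact is needed. This file records
* `upperSomewhere_X_sq_iff_T₂_band` — S2u ↔ «`T₂ Δ' X² 1 < 4(Δ'−1)/Δ'` on some sub-window»;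
* `upperSomewhere_X_sq_of_T₂_nonpos` — «`T₂ Δ' X² 1 ≤ 0` on some sub-window `(a, b) ⊆ [1, min Δ 2]`,
  `a < 3/2`» ⇒ S2u (`0 < 4(Δ'−1)/Δ'` for `Δ' > 1`): the composition tail for ONE-SIDED inputs such as
  the referee's A″ of line `prime-averaged-squeeze` (`T₂ ≤ 0` from a signed block average,
  `KMV2000.T₂_nonpos_of_signedGap_re_average`, HOME/ls-ref-1/lean/SignedSqueeze.lean, not yet in tree)
  or any `T₂ = 0` input (line A's stub via `KMV2000.T₂_eq_zero_of_secondDefect_average_of_le_two`).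
Signatures are in the KMV vocabulary (no route decl): Literature imports only. Nothing here asserts S2u,
the band, or any averaged display (all OPEN; famE-02). Helper for the crux item; standard axioms.
«The programme SEARCHES and TYPES; no claim about Landau–Siegel zeros, Theorems 1–2 of
arXiv:2211.02515 or a repaired Margin232 until a kernel theorem says so.»
-/

namespace Summit.Parity.GeneralizedHardyLittlewood.Theorems.BeyondDiagonalBeatsQuarter

open Polynomial
open Literature.NumberTheory.LFunctions

/-- At the profile `X²`, `Q = 1`, length `Δ' > 0`: `second + t < 2·lin²` iff `t < 4(Δ' − 1)/Δ'`
(`second = 4 + 4/Δ'`, `lin = 2`). [cite: KowalskiMichelVanderKam2000, Thm. 6.1 (30)–(32)] -/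
theorem secondMomentForm_X_sq_add_lt_iff {Δ' : ℝ} (hΔ' : 0 < Δ') (t : ℝ) :
    KMV2000.secondMomentForm Δ' (X ^ 2) 1 + t < 2 * KMV2000.linForm Δ' (X ^ 2) 1 ^ 2 ↔
      t < 4 * (Δ' - 1) / Δ' := by
  rw [KMV2000.secondMomentForm_X_sq_one, KMV2000.linForm_X_sq_one, lt_div_iff₀ hΔ']
  have h1 : 4 / Δ' * Δ' = 4 := div_mul_cancel₀ _ hΔ'.ne'
  constructor
  · intro h
    nlinarith
  · intro h
    nlinarith

/-- **S2u in band form.** The registered heart S2u of the line `birth` (verbatim, left) is equivalent to: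
for every window `(1, Δ]` and every MA-consistent `(T₁, T₂)`, on some sub-window
`(a, b) ⊆ [1, min Δ 2]` with `a < 3/2`, the second-moment off-diagonal main term of the profile `X²`
stays strictly below the diagonal slack, `T₂ Δ' X² 1 < 4(Δ' − 1)/Δ'`. Pure algebra (`Δ' > 0` on the
sub-window since `a ≥ 1`); no printed fact. [cite: KowalskiMichelVanderKam2000, Thm. 6.1 (30)–(32)] -/
theorem upperSomewhere_X_sq_iff_T₂_band :
    (∀ Δ : ℝ, 1 < Δ → ∀ T₁ T₂ : ℝ → ℝ[X] → ℝ[X] → ℝ, KMV2000.MomentAsymptotics 1 Δ T₁ T₂ →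
      ∃ a b : ℝ, 1 ≤ a ∧ a < b ∧ b ≤ min Δ 2 ∧ a < 3 / 2 ∧ ∀ Δ' : ℝ, a < Δ' → Δ' < b →
        KMV2000.secondMomentForm Δ' (X ^ 2) 1 + T₂ Δ' (X ^ 2) 1 <
          2 * KMV2000.linForm Δ' (X ^ 2) 1 ^ 2) ↔
    (∀ Δ : ℝ, 1 < Δ → ∀ T₁ T₂ : ℝ → ℝ[X] → ℝ[X] → ℝ, KMV2000.MomentAsymptotics 1 Δ T₁ T₂ →
      ∃ a b : ℝ, 1 ≤ a ∧ a < b ∧ b ≤ min Δ 2 ∧ a < 3 / 2 ∧ ∀ Δ' : ℝ, a < Δ' → Δ' < b →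
        T₂ Δ' (X ^ 2) 1 < 4 * (Δ' - 1) / Δ') := by
  constructor
  · intro h Δ hΔ T₁ T₂ hMA
    obtain ⟨a, b, ha, hab, hb, ha32, hval⟩ := h Δ hΔ T₁ T₂ hMA
    refine ⟨a, b, ha, hab, hb, ha32, fun Δ' h1 h2 ↦ ?_⟩
    exact (secondMomentForm_X_sq_add_lt_iff (by linarith) _).1 (hval Δ' h1 h2)
  · intro h Δ hΔ T₁ T₂ hMA
    obtain ⟨a, b, ha, hab, hb, ha32, hval⟩ := h Δ hΔ T₁ T₂ hMA
    refine ⟨a, b, ha, hab, hb, ha32, fun Δ' h1 h2 ↦ ?_⟩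
    exact (secondMomentForm_X_sq_add_lt_iff (by linarith) _).2 (hval Δ' h1 h2)

/-- **One-sided inputs suffice: `T₂ ≤ 0` somewhere ⇒ S2u.** If for every window `(1, Δ]` and every
MA-consistent `(T₁, T₂)` the off-diagonal main term of `X²` is NON-POSITIVE on some sub-window
`(a, b) ⊆ [1, min Δ 2]` with `a < 3/2`, then S2u holds (verbatim conclusion): `0 < 4(Δ'−1)/Δ'` for
`Δ' > 1`. The composition tail for sign-one-sided averaged inputs (e.g. a signed block average with
`Re ≤ ε·scale`, which pins `T₂ ≤ 0`). [cite: KowalskiMichelVanderKam2000, Thm. 6.1 (30)–(32)] -/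
theorem upperSomewhere_X_sq_of_T₂_nonpos
    (h : ∀ Δ : ℝ, 1 < Δ → ∀ T₁ T₂ : ℝ → ℝ[X] → ℝ[X] → ℝ, KMV2000.MomentAsymptotics 1 Δ T₁ T₂ →
      ∃ a b : ℝ, 1 ≤ a ∧ a < b ∧ b ≤ min Δ 2 ∧ a < 3 / 2 ∧ ∀ Δ' : ℝ, a < Δ' → Δ' < b →
        T₂ Δ' (X ^ 2) 1 ≤ 0) :
    ∀ Δ : ℝ, 1 < Δ → ∀ T₁ T₂ : ℝ → ℝ[X] → ℝ[X] → ℝ, KMV2000.MomentAsymptotics 1 Δ T₁ T₂ →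
      ∃ a b : ℝ, 1 ≤ a ∧ a < b ∧ b ≤ min Δ 2 ∧ a < 3 / 2 ∧ ∀ Δ' : ℝ, a < Δ' → Δ' < b →
        KMV2000.secondMomentForm Δ' (X ^ 2) 1 + T₂ Δ' (X ^ 2) 1 <
          2 * KMV2000.linForm Δ' (X ^ 2) 1 ^ 2 := by
  refine upperSomewhere_X_sq_iff_T₂_band.2 fun Δ hΔ T₁ T₂ hMA ↦ ?_
  obtain ⟨a, b, ha, hab, hb, ha32, hval⟩ := h Δ hΔ T₁ T₂ hMA
  refine ⟨a, b, ha, hab, hb, ha32, fun Δ' h1 h2 ↦ lt_of_le_of_lt (hval Δ' h1 h2) ?_⟩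
  have hΔ'1 : 1 < Δ' := lt_of_le_of_lt ha h1
  exact div_pos (by linarith) (by linarith)

/-- **`T₂ = 0` on an initial segment ⇒ S2u** (the shape every «diagonal-only beyond the diagonal» input
produces, e.g. line A's squeeze): if for every window and every MA-consistent `(T₁, T₂)` there is
`b' > 1`, `b' ≤ min Δ 2`, with `T₂ Δ' X² 1 = 0` for all `Δ' ∈ (1, b')`, then S2u holds with the
sub-window `(1, min b' (3/2))`. [cite: KowalskiMichelVanderKam2000, Thm. 6.1 (30)–(32)] -/
theorem upperSomewhere_X_sq_of_T₂_eq_zero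
    (h : ∀ Δ : ℝ, 1 < Δ → ∀ T₁ T₂ : ℝ → ℝ[X] → ℝ[X] → ℝ, KMV2000.MomentAsymptotics 1 Δ T₁ T₂ →
      ∃ b' : ℝ, 1 < b' ∧ b' ≤ min Δ 2 ∧ ∀ Δ' : ℝ, 1 < Δ' → Δ' < b' → T₂ Δ' (X ^ 2) 1 = 0) :
    ∀ Δ : ℝ, 1 < Δ → ∀ T₁ T₂ : ℝ → ℝ[X] → ℝ[X] → ℝ, KMV2000.MomentAsymptotics 1 Δ T₁ T₂ →
      ∃ a b : ℝ, 1 ≤ a ∧ a < b ∧ b ≤ min Δ 2 ∧ a < 3 / 2 ∧ ∀ Δ' : ℝ, a < Δ' → Δ' < b →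
        KMV2000.secondMomentForm Δ' (X ^ 2) 1 + T₂ Δ' (X ^ 2) 1 <
          2 * KMV2000.linForm Δ' (X ^ 2) 1 ^ 2 := by
  refine upperSomewhere_X_sq_of_T₂_nonpos fun Δ hΔ T₁ T₂ hMA ↦ ?_
  obtain ⟨b', hb', hb'le, hval⟩ := h Δ hΔ T₁ T₂ hMA
  exact ⟨1, b', le_rfl, hb', hb'le, by norm_num, fun Δ' h1 h2 ↦ (hval Δ' h1 h2).le⟩

end Summit.Parity.GeneralizedHardyLittlewood.Theorems.BeyondDiagonalBeatsQuarter
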